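import Summits.ResolutionOfSingularities.ResolutionOfSingularities.Theorems.FrobeniusLadderFRationalResolutionIsolatedQuotientResolution
import Summits.ResolutionOfSingularities.ResolutionOfSingularities.Theorems.FrobeniusLadderFRationalResolutionIsolatedChartResolutionField
import HarnessLib

/-!
# Crux `FrobeniusLadder.FRationalResolution` (stmt-ResolutionOfSingularities-15317), line `redirect`,
# stub `stub_diagonalizableQuotientResolution` — ISOLATED diagonalizable quotient singularities over an ARBITRARY field are resolvable
# at singular points whose quotient-chart point has TRIVIAL RESIDUE EXTENSION (e.g. `K`-rational chart points), tame or wild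

`…IsolatedQuotientResolution` (✓ p825851) needed `K = K̄` only for the residue condition of brick E-k. Here the ground field is arbitrary
and the condition is carried as a hypothesis at the given chart point `v ↦ x`; it is transported to the sharpened chart point because the
chart change `Spec R → Spec S₀` is a composite of two localizations, hence an OPEN IMMERSION (stalks unchanged).

* `residue_condition_comp` — E-k's residue condition is unchanged by composing the chart with an open immersion;
* `isOpenImmersion_comp_of_isLocalization` — `Spec` of `(T → T_h) ∘ j` is an open immersion when `Spec j` is;
* `exists_sharp_affine_chart_openImmersion` — `…exists_sharp_affine_chart` with the open-immersion clause;
* **`hasResolution_of_isolated_quotient_charts`** — any field `K`: `X` integral lft/K, finitely many singular points, each under a point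
  `v` of an étale quotient chart (ANY finite abelian `A`) with `𝒪_{X,x} → κ(v)` onto ⇒ `Scheme.HasResolution X`;
* **`hasResolution_of_quotient_surface`** — any field: the stub's `hq` verbatim + `dim X ≤ 2` + the residue condition at the singular points
  ⇒ `Scheme.HasResolution X`.

Honest label: the ISOLATED / SURFACE slices of the stub over arbitrary fields MODULO the residue condition (no stub closed by name; the
residue-field-free E-k remains open design). No definitions, no named facts, no sorry.
[cite: Kato1994, (1.5), Def. (2.1), (10.4)] [cite: Kollar2007, §2.2] [cite: Lipman1978, §2] [folklore; cite: SGA3, Exp. VIII §4–5]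
-/

noncomputable section

-- single-problem summit: the doubled namespace component is forced
set_option linter.dupNamespace false

open CategoryTheory AlgebraicGeometry
open Literature.RingTheory.GradedAlgebra
open Literature.AlgebraicGeometry.Resolution Literature.Geometry.PolyhedralFans
open Literature.AlgebraicGeometry.Resolution.LogBlowup Literature.AlgebraicGeometry.Resolution.LogChart
open Literature.AlgebraicGeometry.Resolution.DiagonalizableQuotient
open Summit.ResolutionOfSingularities.ResolutionOfSingularities.Theorems.FRationalResolution

namespace Summit.ResolutionOfSingularities.ResolutionOfSingularities.Theorems.FRationalResolution.IsolatedQuotientResolutionField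

/-- **E-k's residue condition is unchanged by an open immersion of charts**: if `𝒪_{X, φ(ι y')} → κ(ι y')` is onto and `ι` induces
isomorphisms of stalks (an open immersion), then `𝒪_{X, (ι ≫ φ) y'} → κ(y')` is onto. [folklore] -/
theorem residue_condition_comp {Y' Y X : Scheme.{0}} (ι : Y' ⟶ Y) [IsOpenImmersion ι] (φ : Y ⟶ X) (y' : Y')
    (h : ∀ c : Y.presheaf.stalk (ι y'), ∃ b : X.presheaf.stalk (φ (ι y')),
      c - (φ.stalkMap (ι y')).hom b ∈ IsLocalRing.maximalIdeal (Y.presheaf.stalk (ι y'))) :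
    ∀ c : Y'.presheaf.stalk y', ∃ b : X.presheaf.stalk ((ι ≫ φ) y'),
      c - ((ι ≫ φ).stalkMap y').hom b ∈ IsLocalRing.maximalIdeal (Y'.presheaf.stalk y') := by
  intro c
  let e := asIso (ι.stalkMap y')
  obtain ⟨b, hb⟩ := h (e.inv.hom c)
  refine ⟨b, ?_⟩
  have hcomp : ((ι ≫ φ).stalkMap y').hom b = (ι.stalkMap y').hom ((φ.stalkMap (ι y')).hom b) := by
    rw [Scheme.Hom.stalkMap_comp]
    rfl
  have hc : c = (ι.stalkMap y').hom (e.inv.hom c) := by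
    change c = (e.inv ≫ e.hom).hom c
    rw [e.inv_hom_id]
    rfl
  rw [hcomp, hc, ← map_sub]
  rw [IsLocalRing.mem_maximalIdeal, mem_nonunits_iff] at hb ⊢
  exact fun hu => hb (IsLocalHom.map_nonunit _ hu)

/-- **`Spec` of `(T → T_h) ∘ j` is an open immersion when `Spec j` is.** [folklore] -/
theorem isOpenImmersion_comp_of_isLocalization {S₀ T : Type} [CommRing S₀] [CommRing T] (h : T) (R : Type) [CommRing R]
    [Algebra T R] [IsLocalization.Away h R] (j : S₀ →+* T) (hj : IsOpenImmersion (Spec.map (CommRingCat.ofHom j))) :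
    IsOpenImmersion (Spec.map (CommRingCat.ofHom ((algebraMap T R).comp j))) := by
  haveI : IsOpenImmersion (Spec.map (CommRingCat.ofHom (algebraMap T R))) := IsOpenImmersion.of_isLocalization h
  rw [CommRingCat.ofHom_comp, Spec.map_comp]
  infer_instance

/-- **Ring level (with the open-immersion clause): the sharpened fs chart at an arbitrary point of a quotient chart.** Same as
`…IsolatedQuotientResolution.exists_sharp_affine_chart` (✓ p825851), recording in addition that `Spec R → Spec S₀` is an OPEN
IMMERSION (a composite of two localizations), so that stalks — and E-k's residue condition — are unchanged.
[cite: Kato1994, (1.5), Def. (2.1), Prop. (7.1)] [folklore; cite: SGA3, Exp. VIII §4–5] -/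
theorem exists_sharp_affine_chart_openImmersion (k : Type) [Field k] (A : Type) [AddCommGroup A] [Finite A] [DecidableEq A]
    (S : Type) [CommRing S] [Algebra k S] (𝒮 : A → Submodule k S) [GradedAlgebra 𝒮]
    [Algebra.FiniteType k S] [IsRegularRing S] (v : Spec (.of (𝒮 0))) :
    ∃ (R : Type) (_ : CommRing R) (ι : 𝒮 0 →+* R), ι.Etale ∧ IsOpenImmersion (Spec.map (CommRingCat.ofHom ι)) ∧
      ∃ (w : PrimeSpectrum R), w.asIdeal.comap ι = v.asIdeal ∧
      ∃ (n : ℕ) (P : AddSubmonoid (Fin n → ℤ)) (hP : P.FG) (_ : ∀ (u : Fin n → ℤ) (K : ℕ), 0 < K → K • u ∈ P → u ∈ P)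
        (hspan : Submodule.span ℤ (P : Set (Fin n → ℤ)) = ⊤) (χ : Multiplicative P →* R) (g : R),
        g ∉ w.asIdeal ∧ (∀ (𝔭 : Ideal R) [𝔭.IsPrime], g ∉ 𝔭 → IsLogRegularAt P χ 𝔭) ∧
        (∀ p : P, (p : Fin n → ℤ) ≠ 0 → χ (Multiplicative.ofAdd p) ∈ w.asIdeal) ∧
        (Fan.ofCone (dualCone P) (dualCone_fg P hP) (isSalient_dualCone P hspan)).IsPrimSimplicial := by
  classical
  -- (0) the étale localization `S ↦ S_t` with global units in the unit degrees (as in `…EtaleLocalLogRegular`)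
  have hA : AddMonoid.IsTorsion A := fun a => isOfFinAddOrder_of_finite a
  obtain ⟨wS, hwS⟩ := comap_algebraMap_gradeZero_surjective 𝒮 hA v
  let 𝔔 : Ideal S := wS.asIdeal
  haveI h𝔔prime : 𝔔.IsPrime := wS.isPrime
  have h𝔔v : 𝔔.comap (algebraMap (𝒮 0) S) = v.asIdeal := by
    have h := congrArg PrimeSpectrum.asIdeal hwS
    rwa [PrimeSpectrum.comap_asIdeal] at h
  obtain ⟨B, hB, -⟩ := StabilizerSubgroup.exists_unitDegrees_addSubgroup 𝒮 hA 𝔔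
  obtain ⟨t, ht0, -, hT, hloc⟩ := AwayUnits.exists_away_units (k := k) 𝒮 𝔔 B hB
  let L : Type := Localization.Away t
  obtain ⟨hprime, hcomap, hBL, -, hunitL⟩ := hloc L
  let ℒ : A → Submodule k L := locPiece 𝒮 (Submonoid.powers t) hT L
  letI instℒ : GradedAlgebra ℒ := (nonempty_gradedAlgebra_locPiece 𝒮 _ hT L).some
  set 𝔔L : Ideal L := 𝔔.map (algebraMap S L) with h𝔔L
  haveI : 𝔔L.IsPrime := hprime
  haveI : Algebra.FiniteType k L := by
    show Algebra.FiniteType k (Localization (Submonoid.powers t))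
    infer_instance
  haveI : IsRegularRing L := isRegularRing_localization (Submonoid.powers t)
  let j : 𝒮 0 →+* ℒ 0 := locPieceZeroHom 𝒮 (Submonoid.powers t) hT L
  have hjet : j.Etale := FixedChart.etale_locPieceZeroHom 𝒮 ht0 hT L
  set 𝔮₀ : Ideal (ℒ 0) := 𝔔L.comap (algebraMap (ℒ 0) L) with h𝔮₀
  have h𝔮₀v : 𝔮₀.comap j = v.asIdeal := by
    rw [h𝔮₀, Ideal.comap_comap, ← h𝔔v, ← hcomap, Ideal.comap_comap]
    congr 1
  -- (1) the unit-exponent chart at `𝔔L`, log regular on `D(g)`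
  obtain ⟨N, y, c, -, ψ, hψ, g, hg, hreg⟩ :=
    WildLogRegularNhd.exists_nhd_isLogRegularAt_of_units ℒ 𝔔L B hBL hunitL
  have hc : ∀ l, IsOfFinAddOrder (c l) := fun l => hA (c l)
  -- (2) split the exponents: `y_l ∈ 𝔔L` (non-units) / `y_l ∉ 𝔔L`
  let pI : Fin N → Prop := fun l => y l ∈ 𝔔L
  let e : Fin (Fintype.card {l // pI l}) ⊕ Fin (Fintype.card {l // ¬ pI l}) ≃ Fin N :=
    ((Fintype.equivFin {l // pI l}).symm.sumCongr (Fintype.equivFin {l // ¬ pI l}).symm).trans (Equiv.sumCompl pI)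
  have he₁ : ∀ i, y (e (Sum.inl i)) ∈ 𝔔L := fun i => ((Fintype.equivFin {l // pI l}).symm i).2
  have he₂ : ∀ j', y (e (Sum.inr j')) ∉ 𝔔L := fun j' => ((Fintype.equivFin {l // ¬ pI l}).symm j').2
  -- membership of `ψ(p)` in `𝔮₀`: some non-unit exponent is positive
  have hψ_mem : ∀ p, ψ (Multiplicative.ofAdd p) ∈ 𝔮₀ ↔ ∃ i, 0 < ((p : Fin N → ℤ) (e (Sum.inl i))).toNat := by
    intro p
    rw [h𝔮₀, Ideal.mem_comap]
    change ((ψ (Multiplicative.ofAdd p) : ℒ 0) : L) ∈ 𝔔L ↔ _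
    rw [hψ, Ideal.IsPrime.prod_mem_iff]
    constructor
    · rintro ⟨l, -, hl⟩
      have hne : ((p : Fin N → ℤ) l).toNat ≠ 0 := by
        rintro h0
        rw [h0, pow_zero] at hl
        exact ‹𝔔L.IsPrime›.ne_top ((Ideal.eq_top_iff_one _).mpr hl)
      have hyl : y l ∈ 𝔔L := Ideal.IsPrime.mem_of_pow_mem inferInstance _ hl
      obtain ⟨x, rfl⟩ := e.surjective l
      rcases x with i | j'
      · exact ⟨i, Nat.pos_of_ne_zero hne⟩
      · exact absurd hyl (he₂ j')
    · rintro ⟨i, hi⟩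
      exact ⟨e (Sum.inl i), Finset.mem_univ _, Ideal.pow_mem_of_mem 𝔔L (he₁ i) _ hi⟩
  have hg₀ : g ∉ 𝔮₀ := fun h => hg (Ideal.mem_comap.mp h)
  -- (3) the vertical element and the sharpening package over `R = (S_t)_0[1/ψ(z)]`
  obtain ⟨z, hz₁, hz₂⟩ := SharpChart.exists_vertical e c
  let R₁ : Type := Localization.Away (ψ (Multiplicative.ofAdd z))
  obtain ⟨hιet, w, hw₀, P, hP, hsat, hspan, χ, hgw, hregχ, hfix, hps⟩ :=
    IsolatedQuotientResolution.sharp_chart_of_isLocalization e c hc ψ 𝔮₀ hψ_mem g hg₀ hreg z hz₁ hz₂ R₁ j hjet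
  -- the chart map `S₀ → (S_t)_0 → R₁` is a composite of two localizations: an open immersion on spectra
  have hjopen : IsOpenImmersion (Spec.map (CommRingCat.ofHom j)) := by
    letI := gradedMonoid_locPiece 𝒮 (Submonoid.powers t) hT L
    letI := locPieceZeroAlgebra 𝒮 (Submonoid.powers t) hT L
    haveI := FixedChart.isLocalizationAway_locPiece_zero 𝒮 ht0 hT L
    exact IsOpenImmersion.of_isLocalization (⟨t, ht0⟩ : 𝒮 0)
  have hιopen := isOpenImmersion_comp_of_isLocalization (ψ (Multiplicative.ofAdd z)) R₁ j hjopen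
  refine ⟨R₁, inferInstance, (algebraMap (ℒ 0) R₁).comp j, hιet, hιopen, w, ?_, _, P, hP, hsat, hspan, χ,
    algebraMap (ℒ 0) R₁ g, hgw, hregχ, hfix, hps⟩
  rw [← Ideal.comap_comap, hw₀, h𝔮₀v]


/-- **ISOLATED diagonalizable quotient singularities over an arbitrary field, with trivial residue extension at the chart points, are
resolvable (tame or wild).** Let `X` be integral, locally of finite type over a field `K`, with finitely many singular points, each of
which is `φ v` for an étale morphism `φ : Spec S₀ → X` (`S` a REGULAR `K`-algebra of finite type graded by a finite abelian group `A`,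
`S₀ = 𝒮 0`) and a point `v` such that `𝒪_{X, φ v} → κ(v)` is onto (e.g. `v` a `K`-rational point of the `K`-scheme `Spec S₀` over the
`K`-scheme `X`). Then `X` has a resolution of singularities. [cite: Kato1994, (10.4)] [cite: Kollar2007, §2.2] -/
theorem hasResolution_of_isolated_quotient_charts (K : Type) [Field K]
    (X : Scheme.{0}) [IsIntegral X] (f : X ⟶ Spec (.of K)) [LocallyOfFiniteType f]
    (hfin : (Scheme.regularLocus X)ᶜ.Finite)
    (hq : ∀ x : X, x ∉ Scheme.regularLocus X →
      ∃ (A : Type) (_ : AddCommGroup A) (_ : Finite A) (_ : DecidableEq A)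
        (S : Type) (_ : CommRing S) (_ : Algebra K S) (𝒮 : A → Submodule K S)
        (_ : GradedAlgebra 𝒮), Algebra.FiniteType K S ∧ IsRegularRing S ∧
        ∃ (φ : Spec (.of (𝒮 0)) ⟶ X) (_ : Etale φ) (v : Spec (.of (𝒮 0))), φ v = x ∧
          ∀ c : (Spec (.of (𝒮 0))).presheaf.stalk v, ∃ b : X.presheaf.stalk (φ v),
            c - (φ.stalkMap v).hom b ∈ IsLocalRing.maximalIdeal ((Spec (.of (𝒮 0))).presheaf.stalk v)) :
    Scheme.HasResolution X := by
  classical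
  refine IsolatedChartResolutionField.hasResolution_of_isolated_affine_logRegular_charts K X f hfin fun x hx => ?_
  obtain ⟨A, _, _, _, S, _, _, 𝒮, _, hft, hregS, φ, hφ, v, hv, hres⟩ := hq x hx
  haveI := hft
  haveI := hregS
  obtain ⟨R, _, ι, hιet, hιopen, w, hw, n, P, hP, hsat, hspan, χ, g, hgw, hreg, hfix, hps⟩ :=
    exists_sharp_affine_chart_openImmersion K A S 𝒮 v
  haveI : Etale (Spec.map (CommRingCat.ofHom ι)) := (HasRingHomProperty.Spec_iff (P := @Etale)).mpr hιet
  haveI := hιopen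
  have hw' : Spec.map (CommRingCat.ofHom ι) w = v := by
    apply PrimeSpectrum.ext
    rw [Spec.map_apply, PrimeSpectrum.comap_asIdeal]
    exact hw
  subst hw'
  have hres' := residue_condition_comp (Spec.map (CommRingCat.ofHom ι)) φ w hres
  exact ⟨CommRingCat.of R, Spec.map (CommRingCat.ofHom ι) ≫ φ, inferInstance, w, hv, hres', n, P, hP, hsat, hspan, χ, g,
    hgw, hreg, hfix, hps⟩

/-- **Diagonalizable quotient SURFACE singularities over an arbitrary field, with trivial residue extension at the singular chart
points, are resolvable**: the stub's `hq` VERBATIM (finiteness of the singular locus by `…DiagQuotientSurface`), `dim X ≤ 2`, and at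
each singular point one chart point with `𝒪_{X,x} → κ(v)` onto. [cite: Kato1994, (10.4)] [cite: Lipman1978, §2] -/
theorem hasResolution_of_quotient_surface (K : Type) [Field K]
    (X : Scheme.{0}) (g : X ⟶ Spec (.of K)) [IsIntegral X] [LocallyOfFiniteType g] [QuasiCompact g]
    (hq : ∀ x : X, ∃ (A : Type) (_ : AddCommGroup A) (_ : Finite A) (_ : DecidableEq A)
        (S : Type) (_ : CommRing S) (_ : Algebra K S) (𝒮 : A → Submodule K S)
        (_ : GradedAlgebra 𝒮), Algebra.FiniteType K S ∧ IsRegularRing S ∧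
        ∃ φ : Spec (.of (𝒮 0)) ⟶ X, Etale φ ∧ x ∈ Set.range φ ∧
          φ ≫ g = Spec.map (CommRingCat.ofHom (algebraMap K (𝒮 0))))
    (hres : ∀ x : X, x ∉ Scheme.regularLocus X →
      ∃ (A : Type) (_ : AddCommGroup A) (_ : Finite A) (_ : DecidableEq A)
        (S : Type) (_ : CommRing S) (_ : Algebra K S) (𝒮 : A → Submodule K S)
        (_ : GradedAlgebra 𝒮), Algebra.FiniteType K S ∧ IsRegularRing S ∧
        ∃ (φ : Spec (.of (𝒮 0)) ⟶ X) (_ : Etale φ) (v : Spec (.of (𝒮 0))), φ v = x ∧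
          ∀ c : (Spec (.of (𝒮 0))).presheaf.stalk v, ∃ b : X.presheaf.stalk (φ v),
            c - (φ.stalkMap v).hom b ∈ IsLocalRing.maximalIdeal ((Spec (.of (𝒮 0))).presheaf.stalk v))
    (hdim : topologicalKrullDim X ≤ 2) :
    Scheme.HasResolution X := by
  obtain ⟨hfin, -⟩ := DiagQuotientSurface.diagQuotient_surface_singularLocus K X g hq hdim
  exact hasResolution_of_isolated_quotient_charts K X g hfin hres

end Summit.ResolutionOfSingularities.ResolutionOfSingularities.Theorems.FRationalResolution.IsolatedQuotientResolutionField

end
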